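import Literature.Computability.Cryptography.SIS
import HarnessLib

/-!
# Parameter arithmetic of the Micciancio–Regev `GapCVP′ → SIS′` reduction (MR07 Thm. 5.23, NO case)

Topic `Computability/Cryptography` (family `pqc`). Fully PROVED real-arithmetic steps of the NO-case
analysis of **Micciancio–Regev 2007, Thm. 5.23** (authors' version pp. 29–31), pinned to the tree's
renderings of the printed constants — the factor `γ(n) = 14π √n β(n)`
(`Literature.Computability.Cryptography.mrGamma`) and the modulus condition `q(n) ≥ 4 √(m(n)) n^{1.5} β(n)`
(`Literature.Computability.Cryptography.MRModulusCondition`) of `SIS.lean` — for the decomposition of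
`Literature.Computability.Cryptography.MicciancioRegev2007_gapCVP'_to_SIS'`. With the printed
Gaussian width `s = 2√n/(γ d)` (p. 29) and the Lemma 5.20 data `ℓ = 2sβ` (p. 30):

* `MicciancioRegev2007.threshold_testC_lt` — **why `14π`**: the eigenvalue bound of Lemma 5.20 is
  below the verifier's threshold, `3Nℓ² = 12 N s² β² = 48 N n β²/(γ² d²) < N/(2πd)²` (p. 30; with
  `γ = 14π√nβ` the two sides are `48/49` apart). The right-hand side is the quadratic-form threshold of
  `Literature.Algebra.EuclideanLattices.half_le_sum_cos_div_card_of_norm_sub_le`, the left-hand side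
  the bound of `Literature.Probability.Moments.MicciancioRegev2007.measureReal_exists_lt_sum_inner_sq_le`.
* `MicciancioRegev2007.combine_error_le_of_modulusCondition` — the first term of (17) (p. 31):
  `n √m ‖S‖ β / q ≤ 2 β η` when `‖S‖ ≤ 8 β √n η` (Cor. 5.13) and `q ≥ 4 √m n^{1.5} β`
  (`MRModulusCondition`), the distance bound of the combining procedure being
  `Literature.Algebra.EuclideanLattices.MicciancioRegev2007.norm_combine_sub_le_sqrt` with `‖z‖ ≤ β`.
* `MicciancioRegev2007.two_mul_eta_lt_s` — eq. (15) as arithmetic: if `η ≤ √n/λ₁` (Lemma 3.2 for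
  `ε = 2⁻ⁿ`, tree: `smoothingParameter_two_pow_neg_le`) and `γ d < λ₁` (a NO instance of `GapCVP′_γ`)
  then `2η < s`.
* `MicciancioRegev2007.norm_w_le_of` — the last line of (17): `sβ + √n m s β ≤ 2 √n m s β` as soon as
  `1 ≤ √n m`.

## References

* D. Micciancio, O. Regev, *Worst-case to average-case reductions based on Gaussian measures*,
  SIAM J. Comput. 37 (2007) 267–302; authors' version, Thm. 5.23 and its proof, eqs. (15), (17)
  (pp. 28–31) (`lit read doi:10.1137/S0097539705447360`).
-/

noncomputable section

open Real

namespace Literature.Computability.Cryptography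

/-- `γ² = 196 π² n β²` for `γ = 14π √n β`. [cite: MicciancioRegev2007, Thm. 5.23] -/
theorem mrGamma_sq (β : ℕ → ℝ) (n : ℕ) : mrGamma β n ^ 2 = 196 * π ^ 2 * n * β n ^ 2 := by
  unfold mrGamma
  rw [mul_pow, mul_pow, mul_pow, Real.sq_sqrt (Nat.cast_nonneg n)]
  ring

/-- `γ > 0` for `n ≥ 1` and `β n > 0`. [cite: MicciancioRegev2007, Thm. 5.23] -/
theorem mrGamma_pos {β : ℕ → ℝ} {n : ℕ} (hn : 0 < n) (hβ : 0 < β n) : 0 < mrGamma β n := by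
  unfold mrGamma
  have : 0 < Real.sqrt n := Real.sqrt_pos.2 (by exact_mod_cast hn)
  positivity

/-- **Test (c) threshold** (MR07 proof of Thm. 5.23, p. 30: "`3Nℓ² = 12Ns²β² = 48Nnβ²/(γ²d²) <
N/(2πd)²`"): with `γ = 14π√nβ`, `s = 2√n/(γd)` and `ℓ = 2sβ`, for `n ≥ 1`, `β, d, N > 0`, the
Lemma 5.20 bound `3Nℓ²` is strictly below the verifier threshold `N/(2πd)²`.
[cite: MicciancioRegev2007, Thm. 5.23 (proof, p. 30)] -/
theorem MicciancioRegev2007.threshold_testC_lt {β : ℕ → ℝ} {n : ℕ} (hn : 0 < n) (hβ : 0 < β n)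
    {d N : ℝ} (hd : 0 < d) (hN : 0 < N) :
    3 * N * (2 * (2 * Real.sqrt n / (mrGamma β n * d)) * β n) ^ 2 < N / (2 * π * d) ^ 2 := by
  have hγ := mrGamma_pos hn hβ
  have hsn : 0 < Real.sqrt n := Real.sqrt_pos.2 (by exact_mod_cast hn)
  have hπ : 0 < π := Real.pi_pos
  -- rewrite the left-hand side as `48 N n β² / (γ² d²)`
  have hl : 3 * N * (2 * (2 * Real.sqrt n / (mrGamma β n * d)) * β n) ^ 2 =
      48 * N * n * β n ^ 2 / (mrGamma β n ^ 2 * d ^ 2) := by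
    field_simp
    rw [Real.sq_sqrt (Nat.cast_nonneg n)]
    ring
  rw [hl, mrGamma_sq, div_lt_div_iff₀ (by positivity) (by positivity)]
  -- `48 N n β² (2πd)² < N · 196 π² n β² d²`, i.e. `192 < 196`
  have hpos : 0 < N * (π ^ 2 * (n * (β n ^ 2 * d ^ 2))) := by positivity
  nlinarith

/-- **First term of (17)** (MR07 proof of Thm. 5.23, p. 31: "`‖x − Cz‖ ≤ √m n ‖S‖·‖z‖/q ≤
8√m n^{1.5} η β²/q ≤ 2βη`"): if `‖S‖ ≤ 8β√n η` (Cor. 5.13), `0 ≤ ‖z‖ ≤ β` and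
`q ≥ 4√m n^{1.5} β` (`MRModulusCondition`), then `n √m ‖z‖ ‖S‖ / q ≤ 2 β η` (if `q = 0` the left-hand
side is `0` by Lean's convention and the bound still holds).
[cite: MicciancioRegev2007, Thm. 5.23 (proof, eq. (17), p. 31)] -/
theorem MicciancioRegev2007.combine_error_le_of_modulusCondition {q m : ℕ → ℕ} {β : ℕ → ℝ}
    (hmod : MRModulusCondition q m β) {n : ℕ} (hβ : 0 < β n) {η σS nz : ℝ} (hη : 0 ≤ η)
    (hσS : σS ≤ 8 * β n * Real.sqrt n * η) (hnz0 : 0 ≤ nz) (hnz : nz ≤ β n) :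
    n * Real.sqrt (m n) * nz * σS / q n ≤ 2 * β n * η := by
  rcases Nat.eq_zero_or_pos (q n) with hq0 | hqpos
  · rw [hq0, Nat.cast_zero, div_zero]
    positivity
  · have hq : (0 : ℝ) < q n := by exact_mod_cast hqpos
    rw [div_le_iff₀ hq]
    calc (n : ℝ) * Real.sqrt (m n) * nz * σS
        ≤ (n : ℝ) * Real.sqrt (m n) * nz * (8 * β n * Real.sqrt n * η) :=
          mul_le_mul_of_nonneg_left hσS (by positivity)
      _ ≤ (n : ℝ) * Real.sqrt (m n) * β n * (8 * β n * Real.sqrt n * η) := by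
          have h0 : 0 ≤ (n : ℝ) * Real.sqrt (m n) * (8 * β n * Real.sqrt n * η) := by positivity
          nlinarith
      _ = 2 * β n * η * (4 * Real.sqrt (m n) * ((n : ℝ) * Real.sqrt n) * β n) := by ring
      _ ≤ 2 * β n * η * q n := mul_le_mul_of_nonneg_left (hmod n) (by positivity)

/-- **Eq. (15) as arithmetic** (MR07 proof of Thm. 5.23, p. 29: "`η_ε(B*) ≤ √n/λ₁(B) < √n/(γd) =
s/2`, and hence `s > 2η_ε(B*)`"): if `η ≤ √n/λ₁` (Lemma 3.2 with `ε = 2⁻ⁿ`, applied to `B*`, whose dual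
is `B`) and `γ d < λ₁` (a NO instance of `GapCVP′_γ`), then `2η < s = 2√n/(γd)` (`n ≥ 1`).
[cite: MicciancioRegev2007, Thm. 5.23 (proof, eq. (15), p. 29)] -/
theorem MicciancioRegev2007.two_mul_eta_lt_s {β : ℕ → ℝ} {n : ℕ} (hn : 0 < n) (hβ : 0 < β n)
    {d lam η : ℝ} (hd : 0 < d) (hno : mrGamma β n * d < lam) (hη : η ≤ Real.sqrt n / lam) :
    2 * η < 2 * Real.sqrt n / (mrGamma β n * d) := by
  have hγ := mrGamma_pos hn hβ
  have hsn : 0 < Real.sqrt n := Real.sqrt_pos.2 (by exact_mod_cast hn)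
  have hlam : 0 < lam := lt_trans (by positivity) hno
  have hlt : Real.sqrt n / lam < Real.sqrt n / (mrGamma β n * d) :=
    div_lt_div_of_pos_left hsn (by positivity) hno
  rw [mul_div_assoc]
  linarith

/-- **Last line of (17)** (MR07 proof of Thm. 5.23, p. 31: "`sβ + √n m sβ < 2√n m sβ` for all
sufficiently large `n`"): it holds as soon as `1 ≤ √n · m` (e.g. `n, m ≥ 1`), for `s, β ≥ 0`.
[cite: MicciancioRegev2007, Thm. 5.23 (proof, eq. (17), p. 31)] -/
theorem MicciancioRegev2007.norm_w_le_of {s b : ℝ} (hs : 0 ≤ s) (hb : 0 ≤ b) {n m : ℕ}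
    (hnm : 1 ≤ Real.sqrt n * m) :
    s * b + Real.sqrt n * m * s * b ≤ 2 * Real.sqrt n * m * s * b := by
  have h0 : 0 ≤ s * b := mul_nonneg hs hb
  nlinarith

end Literature.Computability.Cryptography

end
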